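import Mathlib
import Literature.AlgebraicGeometry.Resolution.CobordantGame
import Literature.AlgebraicGeometry.Resolution.FormalCoordinateChange
import Summits.ResolutionOfSingularities.ResolutionOfSingularities.Theorems.WeightedInvariantGlobalizeLocalDropCanonize
import Summits.ResolutionOfSingularities.ResolutionOfSingularities.Theorems.WeightedInvariantGlobalizeLocalDropCylinder
import Summits.ResolutionOfSingularities.ResolutionOfSingularities.Theorems.WeightedInvariantLocalWeightedDropTschirnhausFormAux

/-!
# `WeightedInvariant.LocalWeightedDrop`, line `hasse-ridge-face-selection`: RE-CENTRING a monic double point, `y ↦ y + φ(x')`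

Crux item stmt-ResolutionOfSingularities-8899 `LocalWeightedDrop` (route `ResolutionOfSingularities/WeightedInvariant`),
serving the door `WeightedConstruction` stmt-ResolutionOfSingularities-0571.  [OURS · L1 W4.3, chain w43, stub worker 3: the
third move-brick of the wild coefficient game D1 of CRUX-PLAN w43 §3C (companion of `won_monic_of_pointBlowup`,
`won_monic_of_curveBlowup`).  Not a statement of any manuscript.]

`won_monic_two_recentre_iff` (every characteristic, every dimension `m + 1`): for `φ ∈ k[[x']]`, `φ(0) = 0`,
```
  Won (y² + (A₁ + 2φ) y + (A₀ + A₁ φ + φ²))  ↔  Won (y² + A₁ y + A₀)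
```
— the shear `(x', y + φ(x'))` is a legal coordinate change (unipotent linear part; `won_subst_iff`), and
`subst_shear_monic_two` computes the re-centred form.  In characteristic `2`: `(A₁, A₀) ↦ (A₁, A₀ + A₁ φ + φ²)`.  This is the
char-`p` substitute for maximal contact in the wild pieces S2/S3: the hypersurface `y = 0` may be re-chosen before every
move (Hironaka's vertex preparation / CJS re-adaptation), and the prover's rank must be computed after an optimal choice.
-/

set_option linter.dupNamespace false -- mandated namespace of this single-conjunct summit

namespace Summit.ResolutionOfSingularities.ResolutionOfSingularities.Theorems

open Literature.AlgebraicGeometry.Resolution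
open Literature.AlgebraicGeometry.Resolution.CobordantGame

namespace MonicRecentre

open MvPowerSeries

variable {k : Type} [Field k] {m : ℕ}

/-- The re-centring substitution `τ_φ = (x', y + φ(x'))` fixes series in `x'`. -/
theorem subst_shear_rename (φ : MvPowerSeries (Fin m) k) (hφ : constantCoeff φ = 0) (A : MvPowerSeries (Fin m) k) :
    subst (fun l : Fin (m + 1) => if l = Fin.last m then X (Fin.last m) + rename (Fin.succAboveEmb (Fin.last m)) φ else X l)
      (rename (Fin.succAboveEmb (Fin.last m)) A) = rename (Fin.succAboveEmb (Fin.last m)) A := by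
  have h0 : ∀ l, constantCoeff ((fun l : Fin (m + 1) => if l = Fin.last m
      then X (Fin.last m) + rename (Fin.succAboveEmb (Fin.last m)) φ else X l) l) = 0 := by
    intro l
    dsimp only
    split_ifs
    · rw [map_add, constantCoeff_X, constantCoeff_rename, hφ, add_zero]
    · exact constantCoeff_X l
  rw [subst_rename_eq _ _ h0 A]
  have hfun : (fun i : Fin m => (fun l : Fin (m + 1) => if l = Fin.last m
      then X (Fin.last m) + rename (Fin.succAboveEmb (Fin.last m)) φ else X l) (Fin.succAboveEmb (Fin.last m) i)) =
      fun i => X (Fin.succAboveEmb (Fin.last m) i) := by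
    funext i
    dsimp only
    rw [if_neg]
    rw [Fin.coe_succAboveEmb, Fin.succAbove_last]
    exact (Fin.castSucc_lt_last i).ne
  rw [hfun, rename_eq_subst]
  rfl

/-- THE RE-CENTRED DOUBLE POINT (every characteristic): `(y + φ)² + A₁ (y + φ) + A₀ = y² + (A₁ + 2φ) y + (A₀ + A₁ φ + φ²)`. -/
theorem subst_shear_monic_two (φ : MvPowerSeries (Fin m) k) (hφ : constantCoeff φ = 0) (A₀ A₁ : MvPowerSeries (Fin m) k) :
    subst (fun l : Fin (m + 1) => if l = Fin.last m then X (Fin.last m) + rename (Fin.succAboveEmb (Fin.last m)) φ else X l)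
        (X (Fin.last m) ^ 2 +
          (rename (Fin.succAboveEmb (Fin.last m)) A₀ + rename (Fin.succAboveEmb (Fin.last m)) A₁ * X (Fin.last m))) =
      X (Fin.last m) ^ 2 +
        (rename (Fin.succAboveEmb (Fin.last m)) (A₀ + A₁ * φ + φ ^ 2) +
          rename (Fin.succAboveEmb (Fin.last m)) (A₁ + 2 * φ) * X (Fin.last m)) := by
  have h0 : ∀ l, constantCoeff ((fun l : Fin (m + 1) => if l = Fin.last m
      then X (Fin.last m) + rename (Fin.succAboveEmb (Fin.last m)) φ else X l) l) = 0 := by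
    intro l
    dsimp only
    split_ifs
    · rw [map_add, constantCoeff_X, constantCoeff_rename, hφ, add_zero]
    · exact constantCoeff_X l
  have hs := hasSubst_of_constantCoeff_zero h0
  have hY : subst (fun l : Fin (m + 1) => if l = Fin.last m
      then X (Fin.last m) + rename (Fin.succAboveEmb (Fin.last m)) φ else X l)
      (X (Fin.last m) : MvPowerSeries (Fin (m + 1)) k) =
      X (Fin.last m) + rename (Fin.succAboveEmb (Fin.last m)) φ := by
    rw [subst_X hs]
    exact if_pos rfl
  rw [← coe_substAlgHom hs]
  simp only [map_add, map_mul, map_pow, map_ofNat, coe_substAlgHom, hY, subst_shear_rename φ hφ]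
  ring

end MonicRecentre

open MonicRecentre MvPowerSeries in
/-- RE-CENTRING A MONIC DOUBLE POINT (every characteristic, every dimension `m + 1`): for `φ ∈ k[[x']]` with `φ(0) = 0`, the
monic double point `y² + A₁ y + A₀` is won iff the re-centred one `y² + (A₁ + 2φ) y + (A₀ + A₁ φ + φ²)` is — the shear
`(x', y + φ(x'))` is a legal coordinate change (`won_subst_iff`).  In characteristic `2` this is `(A₁, A₀) ↦ (A₁, A₀ + A₁ φ + φ²)`,
the third move of the wild coefficient game (no maximal contact: the hypersurface `y = 0` is re-chosen at will). -/
theorem won_monic_two_recentre_iff {k : Type} [Field k] {m : ℕ} (φ : MvPowerSeries (Fin m) k)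
    (hφ : MvPowerSeries.constantCoeff φ = 0) (A₀ A₁ : MvPowerSeries (Fin m) k) :
    CobordantGame.Won k (m + 1) (MvPowerSeries.X (Fin.last m) ^ 2 +
        (MvPowerSeries.rename (Fin.succAboveEmb (Fin.last m)) (A₀ + A₁ * φ + φ ^ 2) +
          MvPowerSeries.rename (Fin.succAboveEmb (Fin.last m)) (A₁ + 2 * φ) * MvPowerSeries.X (Fin.last m))) ↔
      CobordantGame.Won k (m + 1) (MvPowerSeries.X (Fin.last m) ^ 2 +
        (MvPowerSeries.rename (Fin.succAboveEmb (Fin.last m)) A₀ +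
          MvPowerSeries.rename (Fin.succAboveEmb (Fin.last m)) A₁ * MvPowerSeries.X (Fin.last m))) := by
  classical
  obtain ⟨τ, hτ⟩ : ∃ τ : Fin (m + 1) → MvPowerSeries (Fin (m + 1)) k,
      ∀ l, τ l = if l = Fin.last m then X (Fin.last m) + rename (Fin.succAboveEmb (Fin.last m)) φ else X l :=
    ⟨_, fun _ => rfl⟩
  have hτeq : τ = fun l : Fin (m + 1) => if l = Fin.last m
      then X (Fin.last m) + rename (Fin.succAboveEmb (Fin.last m)) φ else X l := funext hτ
  have hτ0 : ∀ l, constantCoeff (τ l) = 0 := by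
    intro l
    rw [hτ]
    split_ifs
    · rw [map_add, constantCoeff_X, constantCoeff_rename, hφ, add_zero]
    · exact constantCoeff_X l
  have hc1 : coeff (Finsupp.single (Fin.last m) 1) (rename (Fin.succAboveEmb (Fin.last m)) φ) = 0 := by
    have h := TschirnhausForm.coeff_emb_add_single_rename (m := m) (0 : Fin m →₀ ℕ) 1 φ
    rw [Finsupp.embDomain_zero, zero_add, if_neg one_ne_zero] at h
    exact h
  have hτdet : IsUnit (FormalCoordChange.linMat τ).det := by
    rw [FormalCoordChange.linMat, TschirnhausForm.det_of_offLast_rows]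
    · rw [Matrix.of_apply, hτ, if_pos rfl, map_add, coeff_index_single_self_X, hc1, add_zero]
      exact isUnit_one
    · intro l j hl
      rw [Matrix.of_apply, hτ, if_neg hl, coeff_index_single_X]
  rw [← subst_shear_monic_two φ hφ A₀ A₁, ← hτeq]
  exact won_subst_iff hτ0 hτdet _

end Summit.ResolutionOfSingularities.ResolutionOfSingularities.Theorems
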